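import Summits.FinalStateConjecture.FinalStateConjecture.Theorems.EIHFluxBalanceInertialRecessionCalculus
import Literature.Geometry.Lorentzian.ChartCalculus

/-!
# Route EIHFluxBalance — `InertialRecession`: re-charting a lab chart along a smooth self-map

Helper file for the crux `stmt-FinalStateConjecture-10166`
(`Summit.FinalStateConjecture.FinalStateConjecture.Theses.EIHFluxBalance.InertialRecession`).

The conclusion of `InertialRecession` (a `FinalStateDecomposition`) asks for hole charts on the
boosted Kerr exteriors of the FINAL straight motions, while its hypothesis provides one lab chart
`Φ : U → M` in which the holes follow curved, frame-modulated world-lines. The hole charts are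
therefore re-chartings `Ψ = Φ ∘ f` of the lab chart along smooth self-maps `f` of `E4` (Fermi-type
maps following the painted centres). This file is the generic calculus of such re-chartings over
two reference backgrounds `B` (domain `U`, the lab ansatz) and `K` (domain `Ω`, the model), for ANY
smooth `f : E4 → E4` with `f(Ω) ⊆ U` (the sibling file `…Rechart` treats the special case of a
time reparametrisation, where `Df = 1` on the late region):

* `contMDiff_comp_smooth`, `mfderiv_comp_smooth_apply`, `pullbackBilin_comp_smooth` — `Ψ` is
  smooth, `dΨ = dΦ ∘ Df`, `Ψ^* g = (Φ^* g)(f ·)[Df ·, Df ·]`;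
* `deviation_comp_smooth'` (registered one-line form `deviation_comp_smooth`),
  `deviationExtend_comp_smooth_eventuallyEq` — the re-charting identity
  `Ψ^* g − g_K = (Φ^* g − g_B)(f ·)[Df ·, Df ·] + (g_B(f ·)[Df ·, Df ·] − g_K)`;
* `norm_iteratedFDeriv_bilinearComp_fderiv_le'` (registered form without the prime) — the `Cᵐ` estimate of the first term:
  `‖Dᵐ (F(f ·)[Df ·, Df ·])(x)‖ ≤ 4ᵐ m! · max_{j ≤ m} ‖Dʲ F(f x)‖ · D^{m+2}` whenever
  `‖Dʲ f(x)‖ ≤ D` (`1 ≤ j ≤ m + 1`, `D ≥ 1`), for `F` smooth on an open set containing `f x`.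
-/

noncomputable section

open scoped Manifold ContDiff Topology BigOperators
open Filter Set TopologicalSpace Literature.Geometry.Lorentzian

namespace Summit.FinalStateConjecture.FinalStateConjecture.Theorems

/-! ### Re-charting along a smooth self-map of `E4` -/

section CompSmooth

variable {𝓢 : Spacetime 4} {U Ω : Opens E4} {Φ : U → 𝓢.carrier} {f : E4 → E4}
  (hf : ContDiff ℝ ∞ f) (hΩ : ∀ x ∈ Ω, f x ∈ U) {Ψ : Ω → 𝓢.carrier}
  (hΨ : ∀ x, Ψ x = Φ ⟨f x.1, hΩ x.1 x.2⟩)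

include hf hΨ in
/-- The re-charted map `Ψ x = Φ(f x)` is smooth on `Ω` whenever `Φ` is smooth on `U ⊇ f(Ω)`.
[folklore] -/
theorem contMDiff_comp_smooth (hΦ : ContMDiff 𝓘(ℝ, E4) (𝓡 4) ∞ Φ) :
    ContMDiff 𝓘(ℝ, E4) (𝓡 4) ∞ Ψ := by
  let G : Ω → U := fun x ↦ ⟨f x.1, hΩ x.1 x.2⟩
  have hval : ContMDiff 𝓘(ℝ, E4) 𝓘(ℝ, E4) ∞ (Subtype.val ∘ G) :=
    (contMDiff_iff_contDiff.mpr hf).comp contMDiff_subtype_val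
  have hG : ContMDiff 𝓘(ℝ, E4) 𝓘(ℝ, E4) ∞ G := (ContMDiff.subtypeVal_comp_iff U G).1 hval
  have hΨ' : Ψ = Φ ∘ G := funext hΨ
  rw [hΨ']
  exact hΦ.comp hG

include hf in
/-- The differential of the induced map `Ω → U`, `x ↦ f x`, is `Df(x)`. [folklore] -/
theorem mfderiv_codRestrict_smooth_apply (x : Ω) (v : E4) :
    mfderiv 𝓘(ℝ, E4) 𝓘(ℝ, E4) (fun x : Ω ↦ (⟨f x.1, hΩ x.1 x.2⟩ : U)) x v = fderiv ℝ f x.1 v := by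
  let G : Ω → U := fun x ↦ ⟨f x.1, hΩ x.1 x.2⟩
  have hval : ContMDiff 𝓘(ℝ, E4) 𝓘(ℝ, E4) ∞ (Subtype.val ∘ G) :=
    (contMDiff_iff_contDiff.mpr hf).comp contMDiff_subtype_val
  have hG : ContMDiff 𝓘(ℝ, E4) 𝓘(ℝ, E4) ∞ G := (ContMDiff.subtypeVal_comp_iff U G).1 hval
  have h1 : MDifferentiableAt 𝓘(ℝ, E4) 𝓘(ℝ, E4) (Subtype.val : U → E4) (G x) :=
    (contMDiff_subtype_val (n := ∞)).mdifferentiableAt (by simp)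
  have h2 : MDifferentiableAt 𝓘(ℝ, E4) 𝓘(ℝ, E4) G x := hG.mdifferentiableAt (by simp)
  have hc := mfderiv_comp x h1 h2
  have hvalx : mfderiv 𝓘(ℝ, E4) 𝓘(ℝ, E4) (Subtype.val ∘ G) x = fderiv ℝ f x.1 :=
    OpensChart.mfderiv_eq x (Subtype.val ∘ G) f (fun _ ↦ rfl)
      ((hf.differentiable (by simp)).differentiableAt)
  have e1 := OpensChart.mfderiv_subtypeVal_apply (G x) (mfderiv 𝓘(ℝ, E4) 𝓘(ℝ, E4) G x v)
  have e2 : mfderiv 𝓘(ℝ, E4) 𝓘(ℝ, E4) (Subtype.val ∘ G) x v = fderiv ℝ f x.1 v :=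
    DFunLike.congr_fun hvalx v
  rw [hc] at e2
  exact e1.symm.trans e2

include hf hΨ in
/-- Chain rule: the differential of the re-charted map is `dΨ(x) v = dΦ(f x) (Df(x) v)`.
[folklore] -/
theorem mfderiv_comp_smooth_apply (hΦ : ContMDiff 𝓘(ℝ, E4) (𝓡 4) ∞ Φ) (x : Ω) (v : E4) :
    mfderiv 𝓘(ℝ, E4) (𝓡 4) Ψ x v =
      mfderiv 𝓘(ℝ, E4) (𝓡 4) Φ ⟨f x.1, hΩ x.1 x.2⟩ (fderiv ℝ f x.1 v) := by
  let G : Ω → U := fun x ↦ ⟨f x.1, hΩ x.1 x.2⟩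
  have hval : ContMDiff 𝓘(ℝ, E4) 𝓘(ℝ, E4) ∞ (Subtype.val ∘ G) :=
    (contMDiff_iff_contDiff.mpr hf).comp contMDiff_subtype_val
  have hG : ContMDiff 𝓘(ℝ, E4) 𝓘(ℝ, E4) ∞ G := (ContMDiff.subtypeVal_comp_iff U G).1 hval
  have hΨ' : Ψ = Φ ∘ G := funext hΨ
  have h2 : MDifferentiableAt 𝓘(ℝ, E4) 𝓘(ℝ, E4) G x := hG.mdifferentiableAt (by simp)
  have h3 : MDifferentiableAt 𝓘(ℝ, E4) (𝓡 4) Φ (G x) := hΦ.mdifferentiableAt (by simp)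
  have hc2 := mfderiv_comp x h3 h2
  have k : mfderiv 𝓘(ℝ, E4) (𝓡 4) Ψ x = mfderiv 𝓘(ℝ, E4) (𝓡 4) (Φ ∘ G) x := by rw [hΨ']
  refine (DFunLike.congr_fun k v).trans ((DFunLike.congr_fun hc2 v).trans ?_)
  exact congrArg (fun u ↦ mfderiv 𝓘(ℝ, E4) (𝓡 4) Φ (G x) u)
    (mfderiv_codRestrict_smooth_apply hf hΩ x v)

include hf hΨ in
/-- Pullback along the re-charted map: `(Ψ^* g)(x) = (Φ^* g)(f x)[Df(x) ·, Df(x) ·]`. [folklore] -/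
theorem pullbackBilin_comp_smooth (hΦ : ContMDiff 𝓘(ℝ, E4) (𝓡 4) ∞ Φ) (x : Ω) :
    (show E4 →L[ℝ] E4 →L[ℝ] ℝ from pullbackBilin (I := 𝓡 4) (I' := 𝓘(ℝ, E4)) Ψ 𝓢.metric.val x) =
      (show E4 →L[ℝ] E4 →L[ℝ] ℝ from
        pullbackBilin (I := 𝓡 4) (I' := 𝓘(ℝ, E4)) Φ 𝓢.metric.val ⟨f x.1, hΩ x.1 x.2⟩).bilinearComp
        (fderiv ℝ f x.1) (fderiv ℝ f x.1) := by
  refine ContinuousLinearMap.ext fun v ↦ ContinuousLinearMap.ext fun w ↦ ?_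
  change 𝓢.metric.val (Ψ x) (mfderiv 𝓘(ℝ, E4) (𝓡 4) Ψ x v) (mfderiv 𝓘(ℝ, E4) (𝓡 4) Ψ x w) =
    𝓢.metric.val (Φ ⟨f x.1, hΩ x.1 x.2⟩)
      (mfderiv 𝓘(ℝ, E4) (𝓡 4) Φ ⟨f x.1, hΩ x.1 x.2⟩ (fderiv ℝ f x.1 v))
      (mfderiv 𝓘(ℝ, E4) (𝓡 4) Φ ⟨f x.1, hΩ x.1 x.2⟩ (fderiv ℝ f x.1 w))
  rw [mfderiv_comp_smooth_apply hf hΩ hΨ hΦ x v, mfderiv_comp_smooth_apply hf hΩ hΨ hΦ x w, hΨ x]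

end CompSmooth

/-! ### The re-charting identity for metric deviations -/

section Deviation

variable {𝓢 : Spacetime 4} (B K : ModelBackground) {Φ : B.domain → 𝓢.carrier} {f : E4 → E4}
  (hf : ContDiff ℝ ∞ f) (hK : ∀ x ∈ K.domain, f x ∈ B.domain) {Ψ : K.domain → 𝓢.carrier}
  (hΨ : ∀ x, Ψ x = Φ ⟨f x.1, hK x.1 x.2⟩)

include hf hΨ in
/-- **Re-charting identity.** For `Ψ = Φ ∘ f` (`f` smooth, `f(Ω) ⊆ U`):
`Ψ^* g − g_K = (Φ^* g − g_B)(f x)[Df ·, Df ·] + (g_B(f x)[Df ·, Df ·] − g_K(x))` — the deviation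
of the re-charted map from the model `K` is the lab deviation transported by `Df` plus the
deviation of the transported lab reference from the model. [folklore] -/
theorem deviation_comp_smooth' (hΦ : ContMDiff 𝓘(ℝ, E4) (𝓡 4) ∞ Φ) (x : K.domain) :
    𝓢.deviation K Ψ x =
      (𝓢.deviation B Φ ⟨f x.1, hK x.1 x.2⟩).bilinearComp (fderiv ℝ f x.1) (fderiv ℝ f x.1) +
        ((B.bilin (f x.1)).bilinearComp (fderiv ℝ f x.1) (fderiv ℝ f x.1) - K.bilin x.1) := by
  have h1 : 𝓢.deviation K Ψ x =
      (show E4 →L[ℝ] E4 →L[ℝ] ℝ from pullbackBilin (I := 𝓡 4) (I' := 𝓘(ℝ, E4)) Ψ 𝓢.metric.val x) -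
        K.bilin x.1 := rfl
  have h2 : 𝓢.deviation B Φ ⟨f x.1, hK x.1 x.2⟩ =
      (show E4 →L[ℝ] E4 →L[ℝ] ℝ from
        pullbackBilin (I := 𝓡 4) (I' := 𝓘(ℝ, E4)) Φ 𝓢.metric.val ⟨f x.1, hK x.1 x.2⟩) -
        B.bilin (f x.1) := rfl
  rw [h1, h2, pullbackBilin_comp_smooth hf hK hΨ hΦ x]
  refine ContinuousLinearMap.ext fun v ↦ ContinuousLinearMap.ext fun w ↦ ?_
  simp only [ContinuousLinearMap.bilinearComp_apply, sub_apply, add_apply]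
  ring

include hf hΨ in
/-- The re-charting identity for the extended deviations, as an identity of germs at every point
of the (open) model domain. [folklore] -/
theorem deviationExtend_comp_smooth_eventuallyEq (hΦ : ContMDiff 𝓘(ℝ, E4) (𝓡 4) ∞ Φ) {y : E4}
    (hy : y ∈ K.domain) :
    𝓢.deviationExtend K Ψ =ᶠ[𝓝 y] fun z ↦
      (𝓢.deviationExtend B Φ (f z)).bilinearComp (fderiv ℝ f z) (fderiv ℝ f z) +
        ((B.bilin (f z)).bilinearComp (fderiv ℝ f z) (fderiv ℝ f z) - K.bilin z) := by
  filter_upwards [K.domain.isOpen.mem_nhds hy] with z hz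
  have e1 : 𝓢.deviationExtend B Φ (f z) = 𝓢.deviation B Φ ⟨f z, hK z hz⟩ :=
    𝓢.deviationExtend_coe B Φ ⟨f z, hK z hz⟩
  rw [e1]
  exact (𝓢.deviationExtend_coe K Ψ ⟨z, hz⟩).trans (deviation_comp_smooth' B K hf hK hΨ hΦ ⟨z, hz⟩)

end Deviation

/-! ### The `Cᵐ` estimate of a transported form field -/

/-- Derivatives of `y ↦ Df(y) v`: `‖Dˡ (Df(·) v)(x)‖ ≤ ‖v‖ ‖D^{l+1} f(x)‖`. [folklore] -/
theorem norm_iteratedFDeriv_fderiv_apply_le {f : E4 → E4} (hf : ContDiff ℝ ∞ f) (v x : E4)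
    (l : ℕ) :
    ‖iteratedFDeriv ℝ l (fun y ↦ fderiv ℝ f y v) x‖ ≤ ‖v‖ * ‖iteratedFDeriv ℝ (l + 1) f x‖ := by
  have hfd : ContDiff ℝ ∞ (fderiv ℝ f) := hf.fderiv_right (by simp)
  rw [← norm_iteratedFDeriv_fderiv]
  exact norm_iteratedFDeriv_clm_apply_const (hfd.contDiffAt) (by exact_mod_cast le_top)

/-- **`Cᵐ` estimate of a transported form field.** If `F : E4 → (E4 →L E4 →L ℝ)` is smooth on an
open set `W`, `f : E4 → E4` is smooth with `f x ∈ W`, `‖Dʲ F(f x)‖ ≤ C` for `j ≤ m` and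
`‖Dʲ f(x)‖ ≤ D` for `1 ≤ j ≤ m + 1` with `D ≥ 1`, then
`‖Dᵐ (y ↦ F(f y)[Df(y) ·, Df(y) ·])(x)‖ ≤ 4ᵐ m! C D^{m+2}` (chain rule for `F ∘ f`, Leibniz twice
for the two frame slots). [folklore] -/
theorem norm_iteratedFDeriv_bilinearComp_fderiv_le' {F : E4 → E4 →L[ℝ] E4 →L[ℝ] ℝ} {W : Set E4}
    (hW : IsOpen W) (hF : ContDiffOn ℝ ∞ F W) {f : E4 → E4} (hf : ContDiff ℝ ∞ f) {x : E4}
    (hx : f x ∈ W) (m : ℕ) {C D : ℝ} (hC : ∀ j ≤ m, ‖iteratedFDeriv ℝ j F (f x)‖ ≤ C)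
    (hD : ∀ j, 1 ≤ j → j ≤ m + 1 → ‖iteratedFDeriv ℝ j f x‖ ≤ D) (hD1 : 1 ≤ D) :
    ‖iteratedFDeriv ℝ m (fun y ↦ (F (f y)).bilinearComp (fderiv ℝ f y) (fderiv ℝ f y)) x‖ ≤
      4 ^ m * m.factorial * C * D ^ (m + 2) := by
  -- the open neighbourhood `V = f⁻¹(W)` of `x` on which everything is smooth
  set V : Set E4 := f ⁻¹' W with hV
  have hVo : IsOpen V := hW.preimage hf.continuous
  have hxV : x ∈ V := hx
  have hVW : MapsTo f V W := fun _ h ↦ h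
  have hC0 : 0 ≤ C := (norm_nonneg _).trans (hC 0 (Nat.zero_le _))
  have hD0 : 0 ≤ D := zero_le_one.trans hD1
  have hFf : ContDiffOn ℝ ∞ (F ∘ f) V := hF.comp hf.contDiffOn hVW
  have hfd : ContDiff ℝ ∞ (fderiv ℝ f) := hf.fderiv_right (by simp)
  have ha : ∀ v : E4, ContDiff ℝ ∞ (fun y ↦ fderiv ℝ f y v) := fun v ↦ hfd.clm_apply contDiff_const
  -- derivatives of `F ∘ f` on `V`
  have hcomp : ∀ k ≤ m, ‖iteratedFDerivWithin ℝ k (F ∘ f) V x‖ ≤ k.factorial * C * D ^ k := by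
    intro k hk
    have h := norm_iteratedFDerivWithin_comp_le (𝕜 := ℝ) (n := k) (N := ∞) hF hf.contDiffOn
      (by exact_mod_cast le_top) hW.uniqueDiffOn hVo.uniqueDiffOn hVW hxV (C := C) (D := D)
      (fun i hi ↦ by
        rw [iteratedFDerivWithin_of_isOpen i hW hx]
        exact hC i (hi.trans hk))
      (fun i hi1 hik ↦ by
        rw [iteratedFDerivWithin_of_isOpen i hVo hxV]
        calc ‖iteratedFDeriv ℝ i f x‖ ≤ D := hD i hi1 (hik.trans (hk.trans (Nat.le_succ m)))
          _ = D ^ 1 := (pow_one D).symm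
          _ ≤ D ^ i := pow_le_pow_right₀ hD1 hi1)
    exact h
  -- derivatives of the frame slots
  have hslot : ∀ (v : E4) (l : ℕ), l ≤ m →
      ‖iteratedFDerivWithin ℝ l (fun y ↦ fderiv ℝ f y v) V x‖ ≤ ‖v‖ * D := by
    intro v l hl
    rw [iteratedFDerivWithin_of_isOpen l hVo hxV]
    refine (norm_iteratedFDeriv_fderiv_apply_le hf v x l).trans ?_
    exact mul_le_mul_of_nonneg_left (hD (l + 1) (Nat.succ_pos l) (Nat.succ_le_succ hl))
      (norm_nonneg v)
  -- first slot: `y ↦ F(f y)(Df(y) v)`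
  have hone : ∀ (v : E4) (i : ℕ), i ≤ m →
      ‖iteratedFDerivWithin ℝ i (fun y ↦ (F (f y)) (fderiv ℝ f y v)) V x‖ ≤
        2 ^ i * (i.factorial * C * D ^ i) * (‖v‖ * D) := by
    intro v i hi
    have h := norm_iteratedFDerivWithin_clm_apply (𝕜 := ℝ) (f := F ∘ f)
      (g := fun y ↦ fderiv ℝ f y v) (n := i) (N := ∞) hFf (ha v).contDiffOn hVo.uniqueDiffOn hxV
      (by exact_mod_cast le_top)
    refine h.trans (sum_choose_mul_mul_le (by positivity) (fun k hk ↦ ?_) (fun _ ↦ norm_nonneg _)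
      (fun k hk ↦ hslot v k (hk.trans hi)))
    calc ‖iteratedFDerivWithin ℝ k (F ∘ f) V x‖ ≤ k.factorial * C * D ^ k := hcomp k (hk.trans hi)
      _ ≤ i.factorial * C * D ^ i := by
          have h1 : (k.factorial : ℝ) ≤ i.factorial := by exact_mod_cast Nat.factorial_le hk
          have h2 : D ^ k ≤ D ^ i := pow_le_pow_right₀ hD1 hk
          have h3 : (0 : ℝ) ≤ k.factorial := Nat.cast_nonneg _
          calc (k.factorial : ℝ) * C * D ^ k ≤ i.factorial * C * D ^ k :=
                mul_le_mul_of_nonneg_right (mul_le_mul_of_nonneg_right h1 hC0) (pow_nonneg hD0 _)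
            _ ≤ i.factorial * C * D ^ i := mul_le_mul_of_nonneg_left h2 (by positivity)
  -- both slots: `y ↦ F(f y)(Df(y) v)(Df(y) w)`
  have htwo : ∀ v w : E4,
      ‖iteratedFDeriv ℝ m (fun y ↦ (F (f y)) (fderiv ℝ f y v) (fderiv ℝ f y w)) x‖ ≤
        4 ^ m * m.factorial * C * D ^ (m + 2) * ‖v‖ * ‖w‖ := by
    intro v w
    have hcd : ContDiffOn ℝ ∞ (fun y ↦ (F (f y)) (fderiv ℝ f y v)) V :=
      hFf.clm_apply (ha v).contDiffOn
    have h := norm_iteratedFDerivWithin_clm_apply (𝕜 := ℝ) (f := fun y ↦ (F (f y)) (fderiv ℝ f y v))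
      (g := fun y ↦ fderiv ℝ f y w) (n := m) (N := ∞) hcd (ha w).contDiffOn hVo.uniqueDiffOn hxV
      (by exact_mod_cast le_top)
    rw [iteratedFDerivWithin_of_isOpen m hVo hxV] at h
    refine h.trans ((sum_choose_mul_mul_le (α := 2 ^ m * (m.factorial * C * D ^ m) * (‖v‖ * D))
      (by positivity) (fun i hi ↦ ?_) (fun _ ↦ norm_nonneg _) (fun k hk ↦ hslot w k hk)).trans ?_)
    · refine (hone v i hi).trans ?_
      have h1 : (2 : ℝ) ^ i ≤ 2 ^ m := pow_le_pow_right₀ (by norm_num) hi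
      have h2 : (i.factorial : ℝ) ≤ m.factorial := by exact_mod_cast Nat.factorial_le hi
      have h3 : D ^ i ≤ D ^ m := pow_le_pow_right₀ hD1 hi
      have h4 : (i.factorial : ℝ) * C * D ^ i ≤ m.factorial * C * D ^ m :=
        calc (i.factorial : ℝ) * C * D ^ i ≤ m.factorial * C * D ^ i :=
              mul_le_mul_of_nonneg_right (mul_le_mul_of_nonneg_right h2 hC0) (pow_nonneg hD0 _)
          _ ≤ m.factorial * C * D ^ m := mul_le_mul_of_nonneg_left h3 (by positivity)
      exact mul_le_mul_of_nonneg_right (mul_le_mul h1 h4 (by positivity) (by positivity))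
        (by positivity)
    · have : (2 : ℝ) ^ m * (2 ^ m * (m.factorial * C * D ^ m) * (‖v‖ * D)) * (‖w‖ * D) =
          4 ^ m * m.factorial * C * D ^ (m + 2) * ‖v‖ * ‖w‖ := by
        rw [show (4 : ℝ) ^ m = 2 ^ m * 2 ^ m by rw [← mul_pow]; norm_num]
        ring
      rw [this]
  -- assemble via the operator norm of the form-valued derivative
  have hGcd : ContDiffAt ℝ m (fun y ↦ (F (f y)).bilinearComp (fderiv ℝ f y) (fderiv ℝ f y)) x := by
    have h1 : ContDiffAt ℝ ∞ (F ∘ f) x := (hFf x hxV).contDiffAt (hVo.mem_nhds hxV)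
    have h2 : ContDiffAt ℝ ∞ (fderiv ℝ f) x := hfd.contDiffAt
    exact ((contDiffWithinAt_bilinearComp_self (s := univ) h1.contDiffWithinAt
      h2.contDiffWithinAt).contDiffAt univ_mem).of_le (by exact_mod_cast le_top)
  refine norm_iteratedFDeriv_le_of_forall_apply₂ hGcd (by positivity) fun v w ↦ ?_
  have hfun : (fun y ↦ (F (f y)).bilinearComp (fderiv ℝ f y) (fderiv ℝ f y) v w) =
      fun y ↦ (F (f y)) (fderiv ℝ f y v) (fderiv ℝ f y w) := by
    funext y
    rw [ContinuousLinearMap.bilinearComp_apply]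
  rw [hfun]
  exact htwo v w

/-! ### Registered one-line forms -/

/-- Registered sub-goal form (stub `deviation_comp_smooth` of the crux item) of
`deviation_comp_smooth'`. [folklore] -/
theorem deviation_comp_smooth : open Literature.Geometry.Lorentzian in ∀ {𝓢 : Spacetime 4} (B K : ModelBackground) {Φ : B.domain → 𝓢.carrier} {f : E4 → E4}, ContDiff ℝ ((⊤ : ℕ∞) : WithTop ℕ∞) f → ∀ (hK : ∀ x ∈ K.domain, f x ∈ B.domain) {Ψ : K.domain → 𝓢.carrier}, (∀ x, Ψ x = Φ ⟨f x.1, hK x.1 x.2⟩) → ContMDiff 𝓘(ℝ, E4) (𝓡 4) ((⊤ : ℕ∞) : WithTop ℕ∞) Φ → ∀ x : K.domain, 𝓢.deviation K Ψ x = (𝓢.deviation B Φ ⟨f x.1, hK x.1 x.2⟩).bilinearComp (fderiv ℝ f x.1) (fderiv ℝ f x.1) + ((B.bilin (f x.1)).bilinearComp (fderiv ℝ f x.1) (fderiv ℝ f x.1) - K.bilin x.1) :=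
  fun B K _ _ hf hK _ hΨ hΦ x ↦ deviation_comp_smooth' B K hf hK hΨ hΦ x

/-- Registered sub-goal form (stub `norm_iteratedFDeriv_bilinearComp_fderiv_le` of the crux item)
of `norm_iteratedFDeriv_bilinearComp_fderiv_le'`. [folklore] -/
theorem norm_iteratedFDeriv_bilinearComp_fderiv_le : ∀ {F : E4 → E4 →L[ℝ] E4 →L[ℝ] ℝ} {W : Set E4}, IsOpen W → ContDiffOn ℝ ((⊤ : ℕ∞) : WithTop ℕ∞) F W → ∀ {f : E4 → E4}, ContDiff ℝ ((⊤ : ℕ∞) : WithTop ℕ∞) f → ∀ {x : E4}, f x ∈ W → ∀ (m : ℕ) {C D : ℝ}, (∀ j ≤ m, ‖iteratedFDeriv ℝ j F (f x)‖ ≤ C) → (∀ j, 1 ≤ j → j ≤ m + 1 → ‖iteratedFDeriv ℝ j f x‖ ≤ D) → 1 ≤ D → ‖iteratedFDeriv ℝ m (fun y ↦ (F (f y)).bilinearComp (fderiv ℝ f y) (fderiv ℝ f y)) x‖ ≤ 4 ^ m * m.factorial * C * D ^ (m + 2) :=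
  fun hW hF _ hf _ hx m _ _ hC hD hD1 ↦ norm_iteratedFDeriv_bilinearComp_fderiv_le' hW hF hf hx m hC hD hD1

end Summit.FinalStateConjecture.FinalStateConjecture.Theorems

end
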